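import Literature.NumberTheory.Sieve.IwaniecAlmostPrimesWeightedSum
import Literature.NumberTheory.Sieve.FriedlanderIwaniecPrimesProofs
import Literature.NumberTheory.Sieve.ParityBarrierProofs
import Literature.NumberTheory.LFunctions.MertensTail
import Literature.NumberTheory.LFunctions.HallTenenbaumTheorem01
import HarnessLib

/-!
# Iwaniec (1978): Mertens' first theorem for `ρ` and condition (1) of Lemma 2 — PROVED

H. Iwaniec, *Almost-primes represented by quadratic polynomials*, Invent. Math. **47** (1978)
171–188 [cite: IwaniecInventiones1978].  The proof of Proposition 2 (p. 185, "by our assumption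
on the sifting density of `ρ`") feeds the sequence `ℬ = 𝒜_q` with `ω = ρ` into Lemma 2, i.e. into
the linear sieve of Acta Arith. **37** (1980) 307–320 [cite: IwaniecActaArith1980b, Theorem 1],
whose hypothesis (1) is the one-sided Mertens-type condition
`∏_{w ≤ p < z} (1 − ω(p)/p)⁻¹ ≤ (log z / log w)(1 + K / log w)` (`2 ≤ w < z`) with an ABSOLUTE
constant `K`.  For `ω = ρ` (the number of roots of `ν² + 1 ≡ 0 (mod p)`, `ρ(p) = 1 + χ₄(p)`)
this needs Mertens' first theorem for `ρ` with a bounded error,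
`∑_{p ≤ x} ρ(p) log p / p = log x + O(1)`, i.e. Mertens' theorem for the non-principal character
modulo `4`: `∑_{p ≤ x} χ₄(p) log p / p = O(1)` — Apostol, *Introduction to Analytic Number Theory*
(1976), §7.3 eq. (4) with Lemmas 7.5, 7.6 and `L(1, χ₄) ≠ 0` [cite: Apostol1976, §7.3 eq. (4)]
(the case `k = 4` of his Theorem 7.3; for a general irreducible polynomial this is Nagell's
theorem, the input of arXiv:1910.02885 Lemma 14).  Everything in this file is PROVED:

* `sum_range_chi4R`, `abs_sum_Ico_chi4R_le` — the partial sums of `χ₄` are `0` or `1`;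
  `abs_sum_mul_le_of_partialSums` — Abel's inequality; `exists_chiDivSum_lim`
  (`A(N) = ∑_{n ≤ N} χ₄(n)/n = L₀ + O(1/N)`, `L₀ ≥ 5/12`), `exists_chiLogDivSum_lim`
  (`B(N) = ∑_{n ≤ N} χ₄(n) log n/n = L₁ + O(log N/N)`) — Apostol Thm 6.18 for `χ₄`, with the
  positivity `L(1, χ₄) > 0` read off the partial sum `A(3) = 2/3` (Apostol Thm 6.20 for `χ₄`);
* `sum_moebius_chiDiv_mul_chiDivSum` (`∑_{d ≤ N} μ(d)χ₄(d)/d · A(N/d) = 1`) and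
  `exists_abs_moebiusChiDivSum_le` (`∑_{d ≤ N} μ(d)χ₄(d)/d = O(1)`) — Apostol Lemma 7.6;
  `sum_vonMangoldt_mul_chiDiv`, `exists_abs_sum_vonMangoldt_mul_chiDiv_le`
  (`∑_{n ≤ N} Λ(n)χ₄(n)/n = O(1)`) — Apostol Lemma 7.5; `abs_sum_nonprime_vonMangoldt_chiDiv_le`
  (higher prime powers contribute at most `∑_p log p/(p(p−1)) ≤ 2`);
  `exists_abs_sum_chi4R_log_div_le` — Apostol §7.3 eq. (4) for `χ₄`;
* `RhoMertensStrong_holds : RhoMertensStrong` — `|∑_{p ≤ t} ρ(p) log p/p − log t| ≤ C` for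
  `t ≥ 1`, from the above and the tree's two-sided Mertens I
  (`Literature.NumberTheory.LFunctions.MertensBound.sum_log_div_prime_bounds`);
* `sum_Ioc_rho_div_le`, `sum_rho_div_filter_le` — the tail form of Mertens II for `ρ`,
  `∑_{w ≤ p < z} ρ(p)/p ≤ log(log z/log w) + C₂/log w` (partial summation, after
  `Literature.NumberTheory.LFunctions.MertensBound.loglog_sub_loglog_le_sum_inv_prime`);
* `prod_inv_one_sub_rho_div_le`, `rho_sieveConditionOne` — **condition (1) of Lemma 2 for
  `ω = ρ`** with an explicit absolute `K ≥ 1`, in exactly the form consumed by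
  `lemma2_bilinearSieve`.

## References

* H. Iwaniec, Invent. Math. 47 (1978) 171–188, §5 p. 185 (`IwaniecInventiones1978`).
* H. Iwaniec, Acta Arith. 37 (1980) 307–320, condition (1) p. 308 (`IwaniecActaArith1980b`).
* T. M. Apostol, *Introduction to Analytic Number Theory*, Springer 1976, §7.3 (Theorem 7.3,
  eq. (4), Lemmas 7.5, 7.6), Theorems 6.18, 6.20 (`Apostol1976`).
* G. H. Hardy, E. M. Wright, *An Introduction to the Theory of Numbers*, Thm 425, 427
  (`HardyWright2008`) — the Mertens estimates of the tree used here.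
-/

open Finset Real Filter MeasureTheory
open scoped Topology ArithmeticFunction.Moebius ArithmeticFunction.zeta

noncomputable section

namespace Literature.NumberTheory.Sieve.Iwaniec1978


open FriedlanderIwaniecPrimes (chi4R chi4R_eq_ite chi4R_mul abs_chi4R_le_one chi4R_zero chi4R_one)

/-! ### Partial sums of `χ₄` are `0` or `1` -/

/-- The partial sums `∑_{n < N} χ₄(n)` are `1` if `N ≡ 2, 3 (mod 4)` and `0` otherwise. [folklore] -/
theorem sum_range_chi4R (N : ℕ) :
    ∑ n ∈ Finset.range N, chi4R n = if N % 4 = 2 ∨ N % 4 = 3 then 1 else 0 := by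
  induction N with
  | zero => simp
  | succ N ih =>
    rw [Finset.sum_range_succ, ih, chi4R_eq_ite]
    have h4 : N % 4 = 0 ∨ N % 4 = 1 ∨ N % 4 = 2 ∨ N % 4 = 3 := by omega
    rcases h4 with h | h | h | h
    · rw [if_neg (by omega), if_pos (by omega), if_neg (by omega)]; norm_num
    · rw [if_neg (by omega), if_neg (by omega), if_pos (by omega), if_pos (by omega)]; norm_num
    · rw [if_pos (by omega), if_pos (by omega), if_pos (by omega)]; norm_num
    · rw [if_pos (by omega), if_neg (by omega), if_neg (by omega), if_neg (by omega)]; norm_num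

/-- `0 ≤ ∑_{n < N} χ₄(n) ≤ 1`. [folklore] -/
theorem sum_range_chi4R_mem (N : ℕ) :
    0 ≤ ∑ n ∈ Finset.range N, chi4R n ∧ ∑ n ∈ Finset.range N, chi4R n ≤ 1 := by
  rw [sum_range_chi4R]; split_ifs <;> norm_num

/-- `|∑_{a ≤ n < b} χ₄(n)| ≤ 1`. [folklore] -/
theorem abs_sum_Ico_chi4R_le (a b : ℕ) : |∑ n ∈ Ico a b, chi4R n| ≤ 1 := by
  rcases le_or_gt a b with hab | hab
  · rw [Finset.sum_Ico_eq_sub _ hab]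
    have h1 := sum_range_chi4R_mem a
    have h2 := sum_range_chi4R_mem b
    rw [abs_le]; constructor <;> linarith [h1.1, h1.2, h2.1, h2.2]
  · rw [Finset.Ico_eq_empty (by omega)]; simp

/-! ### Abel's inequality: bounded partial sums against a non-increasing nonnegative weight -/

/-- **Abel's inequality**: if the partial sums of `c` are bounded by `B` and the weight `w` is
non-increasing and nonnegative on `[0, n)`, then `|∑_{i<n} w(i) c(i)| ≤ B w(0)`
(Apostol Thm 4.2 / Hardy–Wright Thm 421, discrete form). [folklore] -/
theorem abs_sum_mul_le_of_partialSums {c w : ℕ → ℝ} {B : ℝ} (n : ℕ) (hB : 0 ≤ B)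
    (hc : ∀ i, i ≤ n → |∑ j ∈ Finset.range i, c j| ≤ B)
    (hw : ∀ i, i + 1 < n → w (i + 1) ≤ w i) (hw0 : 0 ≤ w 0) (hwn : ∀ i, i < n → 0 ≤ w i) :
    |∑ i ∈ Finset.range n, w i * c i| ≤ B * w 0 := by
  rcases Nat.eq_zero_or_pos n with rfl | hn
  · simp; positivity
  have hparts := Finset.sum_range_by_parts w c n
  simp only [smul_eq_mul] at hparts
  rw [hparts]
  have h1 : |w (n - 1) * ∑ i ∈ Finset.range n, c i| ≤ w (n - 1) * B := by
    rw [abs_mul, abs_of_nonneg (hwn _ (by omega))]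
    exact mul_le_mul_of_nonneg_left (hc n le_rfl) (hwn _ (by omega))
  have h2 : |∑ i ∈ Finset.range (n - 1), (w (i + 1) - w i) * ∑ j ∈ Finset.range (i + 1), c j| ≤
      ∑ i ∈ Finset.range (n - 1), (w i - w (i + 1)) * B := by
    refine (Finset.abs_sum_le_sum_abs _ _).trans (Finset.sum_le_sum fun i hi => ?_)
    have hi' : i + 1 < n := by have := Finset.mem_range.mp hi; omega
    rw [abs_mul, show |w (i + 1) - w i| = w i - w (i + 1) by
      rw [abs_sub_comm]; exact abs_of_nonneg (by linarith [hw i hi'])]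
    exact mul_le_mul_of_nonneg_left (hc (i + 1) (by omega)) (by linarith [hw i hi'])
  have h3 : ∑ i ∈ Finset.range (n - 1), (w i - w (i + 1)) * B = (w 0 - w (n - 1)) * B := by
    rw [← Finset.sum_mul, Finset.sum_range_sub']
  calc |w (n - 1) * ∑ i ∈ Finset.range n, c i -
        ∑ i ∈ Finset.range (n - 1), (w (i + 1) - w i) * ∑ j ∈ Finset.range (i + 1), c j|
      ≤ |w (n - 1) * ∑ i ∈ Finset.range n, c i| +
        |∑ i ∈ Finset.range (n - 1), (w (i + 1) - w i) * ∑ j ∈ Finset.range (i + 1), c j| :=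
        abs_sub _ _
    _ ≤ w (n - 1) * B + (w 0 - w (n - 1)) * B := by rw [← h3]; exact add_le_add h1 h2
    _ = B * w 0 := by ring

/-- `|∑_{a ≤ n < b} χ₄(n) g(n)| ≤ g(a)` for `g` non-increasing and nonnegative on `[a, ∞)`. [folklore] -/
theorem abs_sum_Ico_chi4R_mul_le {g : ℕ → ℝ} {a b : ℕ}
    (hg : ∀ i, a ≤ i → g (i + 1) ≤ g i) (hg0 : ∀ i, a ≤ i → 0 ≤ g i) :
    |∑ n ∈ Ico a b, chi4R n * g n| ≤ g a := by
  rw [Finset.sum_Ico_eq_sum_range]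
  have h := abs_sum_mul_le_of_partialSums (c := fun i => chi4R (a + i)) (w := fun i => g (a + i))
    (B := 1) (b - a) zero_le_one ?_ ?_ ?_ ?_
  · simpa [mul_comm] using h
  · intro i _
    have : ∑ j ∈ Finset.range i, chi4R (a + j) = ∑ n ∈ Ico a (a + i), chi4R n := by
      rw [Finset.sum_Ico_eq_sum_range, Nat.add_sub_cancel_left]
    rw [this]; exact abs_sum_Ico_chi4R_le _ _
  · intro i _; rw [← add_assoc]; exact hg _ (by omega)
  · simpa using hg0 a le_rfl
  · intro i _; exact hg0 _ (by omega)

/-! ### The two Dirichlet series at `s = 1` -/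

/-- `A(N) = ∑_{n ≤ N} χ₄(n)/n`. [folklore] -/
def chiDivSum (N : ℕ) : ℝ := ∑ n ∈ Ioc 0 N, chi4R n / n

/-- `B(N) = ∑_{n ≤ N} χ₄(n) log n / n`. [folklore] -/
def chiLogDivSum (N : ℕ) : ℝ := ∑ n ∈ Ioc 0 N, Real.log n * (chi4R n / n)

/-- `A(N) − A(M)` as a sum over `(M, N]`. [folklore] -/
theorem chiDivSum_sub (M N : ℕ) (h : M ≤ N) :
    chiDivSum N - chiDivSum M = ∑ n ∈ Ico (M + 1) (N + 1), chi4R n * (n : ℝ)⁻¹ := by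
  unfold chiDivSum
  rw [← Finset.sum_Ioc_consecutive _ (Nat.zero_le M) h, add_sub_cancel_left]
  rw [show Ioc M N = Ico (M + 1) (N + 1) from (Finset.Ico_add_one_add_one_eq_Ioc M N).symm]
  exact Finset.sum_congr rfl fun n _ => by rw [div_eq_mul_inv]

/-- `|A(N) − A(M)| ≤ 1/(M+1)` for `M ≤ N` (Abel's inequality; Apostol Thm 6.18 for `χ₄`).
[cite: Apostol1976, Theorem 6.18] -/
theorem abs_chiDivSum_sub_le (M N : ℕ) (h : M ≤ N) :
    |chiDivSum N - chiDivSum M| ≤ ((M : ℝ) + 1)⁻¹ := by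
  rw [chiDivSum_sub M N h]
  have := abs_sum_Ico_chi4R_mul_le (g := fun n : ℕ => (n : ℝ)⁻¹) (a := M + 1) (b := N + 1)
    (fun i hi => by
      have h0 : (0 : ℝ) < i := by exact_mod_cast (show 0 < i by omega)
      push_cast
      exact inv_anti₀ h0 (by linarith))
    (fun i _ => by positivity)
  simpa using this

/-- `B(N) − B(M)` as a sum over `(M, N]`. [folklore] -/
theorem chiLogDivSum_sub (M N : ℕ) (h : M ≤ N) :
    chiLogDivSum N - chiLogDivSum M =
      ∑ n ∈ Ico (M + 1) (N + 1), chi4R n * (Real.log n / n) := by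
  unfold chiLogDivSum
  rw [← Finset.sum_Ioc_consecutive _ (Nat.zero_le M) h, add_sub_cancel_left]
  rw [show Ioc M N = Ico (M + 1) (N + 1) from (Finset.Ico_add_one_add_one_eq_Ioc M N).symm]
  exact Finset.sum_congr rfl fun n _ => by ring

/-- `log n / n` is non-increasing from `n = 3` on. [folklore] -/
theorem log_div_succ_le {i : ℕ} (hi : 3 ≤ i) :
    Real.log ((i + 1 : ℕ) : ℝ) / ((i + 1 : ℕ) : ℝ) ≤ Real.log i / i := by
  have he : Real.exp 1 ≤ 3 := by have := Real.exp_one_lt_d9; linarith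
  have h3 : (3 : ℝ) ≤ i := by exact_mod_cast hi
  have h1 : (i : ℝ) ∈ Set.Ici (Real.exp 1) := Set.mem_Ici.mpr (he.trans h3)
  have h2 : (((i + 1 : ℕ) : ℝ)) ∈ Set.Ici (Real.exp 1) := by
    refine Set.mem_Ici.mpr (he.trans ?_); push_cast; linarith
  exact Real.log_div_self_antitoneOn h1 h2 (by push_cast; linarith)

/-- `|B(N) − B(M)| ≤ log(M+1)/(M+1)` for `2 ≤ M ≤ N` (Abel's inequality; Apostol Thm 6.18 for
`χ₄`). [cite: Apostol1976, Theorem 6.18] -/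
theorem abs_chiLogDivSum_sub_le (M N : ℕ) (hM : 2 ≤ M) (h : M ≤ N) :
    |chiLogDivSum N - chiLogDivSum M| ≤ Real.log ((M : ℝ) + 1) / ((M : ℝ) + 1) := by
  rw [chiLogDivSum_sub M N h]
  have := abs_sum_Ico_chi4R_mul_le (g := fun n : ℕ => Real.log n / n) (a := M + 1) (b := N + 1)
    (fun i hi => log_div_succ_le (by omega))
    (fun i hi => div_nonneg (Real.log_natCast_nonneg _) (Nat.cast_nonneg _))
  simpa using this

/-- A sequence with tails bounded by `e(M) → 0` converges, with the same bound for the limit. [folklore] -/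
theorem exists_lim_of_tail_le {u e : ℕ → ℝ} (M₀ : ℕ)
    (h : ∀ M N, M₀ ≤ M → M ≤ N → |u N - u M| ≤ e M) (he : Tendsto e atTop (𝓝 0)) :
    ∃ L : ℝ, Tendsto u atTop (𝓝 L) ∧ ∀ M, M₀ ≤ M → |u M - L| ≤ e M := by
  have hcs : CauchySeq u := by
    refine Metric.cauchySeq_iff'.mpr fun ε hε => ?_
    obtain ⟨M, hM⟩ := ((he.eventually (gt_mem_nhds hε)).and (eventually_ge_atTop M₀)).exists
    refine ⟨M, fun n hn => ?_⟩
    rw [Real.dist_eq]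
    exact (h M n hM.2 hn).trans_lt hM.1
  obtain ⟨L, hL⟩ := cauchySeq_tendsto_of_complete hcs
  refine ⟨L, hL, fun M hM => ?_⟩
  have h1 : Tendsto (fun N => |u N - u M|) atTop (𝓝 |L - u M|) :=
    (continuous_abs.tendsto _).comp (hL.sub_const (u M))
  have h2 : |L - u M| ≤ e M :=
    le_of_tendsto h1 (eventually_atTop.mpr ⟨M, fun N hN => h M N hM hN⟩)
  rwa [abs_sub_comm] at h2

/-- `L₀ = ∑ χ₄(n)/n` (`= π/4`, not needed): `|A(N) − L₀| ≤ 1/(N+1)` and `L₀ ≥ 5/12`. [folklore] -/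
theorem exists_chiDivSum_lim :
    ∃ L₀ : ℝ, 5 / 12 ≤ L₀ ∧ ∀ N : ℕ, |chiDivSum N - L₀| ≤ ((N : ℝ) + 1)⁻¹ := by
  have he : Tendsto (fun M : ℕ => ((M : ℝ) + 1)⁻¹) atTop (𝓝 0) := by
    have : Tendsto (fun M : ℕ => (M : ℝ) + 1) atTop atTop :=
      tendsto_atTop_add_const_right _ 1 tendsto_natCast_atTop_atTop
    exact tendsto_inv_atTop_zero.comp this
  obtain ⟨L, -, hL⟩ := exists_lim_of_tail_le (u := chiDivSum) (e := fun M : ℕ => ((M : ℝ) + 1)⁻¹)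
    0 (fun M N _ h => abs_chiDivSum_sub_le M N h) he
  · refine ⟨L, ?_, fun N => hL N (Nat.zero_le N)⟩
    have h3 := hL 3 (by norm_num)
    have hA3 : chiDivSum 3 = 2 / 3 := by
      unfold chiDivSum
      rw [show Ioc 0 3 = {1, 2, 3} by decide]
      rw [Finset.sum_insert (by decide), Finset.sum_insert (by decide), Finset.sum_singleton]
      rw [show chi4R 1 = 1 from chi4R_one, show chi4R 2 = 0 by rw [chi4R_eq_ite]; norm_num,
        show chi4R 3 = -1 by rw [chi4R_eq_ite]; norm_num]
      norm_num
    rw [hA3, abs_le] at h3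
    norm_num at h3
    linarith [h3.1, h3.2]

/-- `L₁ = ∑ χ₄(n) log n / n`: `|B(N) − L₁| ≤ log(N+1)/(N+1)` for `N ≥ 2`, and `|L₁| ≤ log 3 / 3`. [folklore] -/
theorem exists_chiLogDivSum_lim :
    ∃ L₁ : ℝ, |L₁| ≤ Real.log 3 / 3 ∧
      ∀ N : ℕ, 2 ≤ N → |chiLogDivSum N - L₁| ≤ Real.log ((N : ℝ) + 1) / ((N : ℝ) + 1) := by
  have he : Tendsto (fun M : ℕ => Real.log ((M : ℝ) + 1) / ((M : ℝ) + 1)) atTop (𝓝 0) := by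
    have h1 : Tendsto (fun M : ℕ => (M : ℝ) + 1) atTop atTop :=
      tendsto_atTop_add_const_right _ 1 tendsto_natCast_atTop_atTop
    have h2 : Tendsto (fun x : ℝ => Real.log x / x) atTop (𝓝 0) := by
      have := Real.tendsto_pow_log_div_mul_add_atTop 1 0 1 one_ne_zero
      simpa using this
    exact h2.comp h1
  obtain ⟨L, -, hL⟩ := exists_lim_of_tail_le (u := chiLogDivSum)
    (e := fun M : ℕ => Real.log ((M : ℝ) + 1) / ((M : ℝ) + 1)) 2
    (fun M N hM h => abs_chiLogDivSum_sub_le M N hM h) he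
  · refine ⟨L, ?_, hL⟩
    have h2 := hL 2 le_rfl
    have hB2 : chiLogDivSum 2 = 0 := by
      unfold chiLogDivSum
      rw [show Ioc 0 2 = {1, 2} by decide, Finset.sum_insert (by decide), Finset.sum_singleton]
      rw [show chi4R 2 = 0 by rw [chi4R_eq_ite]; norm_num]
      simp
    rw [hB2, zero_sub, abs_neg] at h2
    norm_num at h2
    exact h2


/-! ### The weight `a(n) = χ₄(n)/n` and the two convolution identities -/

/-- `a(n) = χ₄(n)/n`, a completely multiplicative weight. [folklore] -/
def chiDiv (n : ℕ) : ℝ := chi4R n / n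

/-- `a` is completely multiplicative. [folklore] -/
theorem chiDiv_mul (d m : ℕ) : chiDiv (d * m) = chiDiv d * chiDiv m := by
  unfold chiDiv; rw [chi4R_mul]; push_cast; rw [div_mul_div_comm]

/-- `a(1) = 1`. [folklore] -/
theorem chiDiv_one : chiDiv 1 = 1 := by simp [chiDiv, chi4R_one]

/-- `|a(n)| ≤ 1/n`. [folklore] -/
theorem abs_chiDiv_le (n : ℕ) : |chiDiv n| ≤ (n : ℝ)⁻¹ := by
  unfold chiDiv
  rcases Nat.eq_zero_or_pos n with rfl | hn
  · simp [chi4R_zero]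
  · have hn' : (0 : ℝ) < n := by exact_mod_cast hn
    rw [abs_div, abs_of_pos hn', div_eq_mul_inv]
    exact mul_le_of_le_one_left (by positivity) (abs_chi4R_le_one n)

/-- `A(N) = ∑_{n ≤ N} a(n)`. [folklore] -/
theorem chiDivSum_eq (N : ℕ) : chiDivSum N = ∑ n ∈ Ioc 0 N, chiDiv n := rfl

/-- `B(N) = ∑_{n ≤ N} log n · a(n)`. [folklore] -/
theorem chiLogDivSum_eq (N : ℕ) : chiLogDivSum N = ∑ n ∈ Ioc 0 N, Real.log n * chiDiv n := rfl

/-- `G(N) = ∑_{d ≤ N} μ(d) χ₄(d)/d`. [folklore] -/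
def moebiusChiDivSum (N : ℕ) : ℝ := ∑ d ∈ Ioc 0 N, (ArithmeticFunction.moebius d : ℝ) * chiDiv d

open ArithmeticFunction in
/-- Identity (I) (Apostol, proof of Lemma 7.6): `∑_{d ≤ N} μ(d) a(d) A(N/d) = 1` for `N ≥ 1`. [folklore] -/
theorem sum_moebius_chiDiv_mul_chiDivSum {N : ℕ} (hN : 1 ≤ N) :
    ∑ d ∈ Ioc 0 N, (μ d : ℝ) * chiDiv d * chiDivSum (N / d) = 1 := by
  have h := Literature.NumberTheory.Sieve.sum_Ioc_mul_apply_mul_eq_sum_sum (μ : ArithmeticFunction ℝ)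
    (ζ : ArithmeticFunction ℝ) chiDiv N
  rw [coe_moebius_mul_coe_zeta] at h
  have hl : ∑ n ∈ Ioc 0 N, (1 : ArithmeticFunction ℝ) n * chiDiv n = 1 := by
    rw [Finset.sum_eq_single 1]
    · simp [chiDiv_one]
    · intro n _ hn; rw [one_apply_ne hn, zero_mul]
    · intro h1; exact absurd (Finset.mem_Ioc.mpr ⟨zero_lt_one, hN⟩) h1
  rw [hl] at h
  rw [h]
  refine Finset.sum_congr rfl fun d _ => ?_
  rw [intCoe_apply, mul_assoc]
  congr 1
  rw [chiDivSum_eq, Finset.mul_sum]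
  refine Finset.sum_congr rfl fun m hm => ?_
  have hm0 : m ≠ 0 := (Finset.mem_Ioc.mp hm).1.ne'
  rw [natCoe_apply, zeta_apply_ne hm0, Nat.cast_one, one_mul, chiDiv_mul]

open ArithmeticFunction in
/-- Identity (II) (Apostol, proof of Lemma 7.5):
`∑_{n ≤ N} Λ(n) a(n) = ∑_{d ≤ N} μ(d) a(d) B(N/d)`. [folklore] -/
theorem sum_vonMangoldt_mul_chiDiv (N : ℕ) :
    ∑ n ∈ Ioc 0 N, Λ n * chiDiv n =
      ∑ d ∈ Ioc 0 N, (μ d : ℝ) * chiDiv d * chiLogDivSum (N / d) := by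
  have h := Literature.NumberTheory.Sieve.sum_Ioc_mul_apply_mul_eq_sum_sum (μ : ArithmeticFunction ℝ)
    ArithmeticFunction.log chiDiv N
  rw [moebius_mul_log_eq_vonMangoldt] at h
  rw [h]
  refine Finset.sum_congr rfl fun d _ => ?_
  rw [intCoe_apply, mul_assoc]
  congr 1
  rw [chiLogDivSum_eq, Finset.mul_sum]
  refine Finset.sum_congr rfl fun m _ => ?_
  rw [log_apply, chiDiv_mul]; ring

/-! ### Bounds -/

/-- `N ≤ d (⌊N/d⌋ + 1)`. [folklore] -/
theorem natCast_le_mul_div_add_one (N : ℕ) {d : ℕ} (hd : 0 < d) :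
    (N : ℝ) ≤ d * ((N / d : ℕ) + 1) := by
  have := Nat.lt_div_mul_add (a := N) hd
  have h : (N : ℝ) < ((N / d : ℕ) : ℝ) * d + d := by exact_mod_cast this
  nlinarith

/-- `d⁻¹ (⌊N/d⌋ + 1)⁻¹ ≤ 1/N` for `1 ≤ d ≤ N`. [folklore] -/
theorem inv_mul_inv_div_add_one_le {N d : ℕ} (hd : 0 < d) (hN : 0 < N) :
    (d : ℝ)⁻¹ * (((N / d : ℕ) : ℝ) + 1)⁻¹ ≤ (N : ℝ)⁻¹ := by
  have h := natCast_le_mul_div_add_one N hd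
  have hd' : (0 : ℝ) < d := by exact_mod_cast hd
  have hN' : (0 : ℝ) < N := by exact_mod_cast hN
  have hK : (0 : ℝ) < ((N / d : ℕ) : ℝ) + 1 := by positivity
  rw [← mul_inv, inv_le_inv₀ (by positivity) hN']
  exact h

/-- `|μ(d)| ≤ 1` in `ℝ`. [folklore] -/
theorem abs_moebius_cast_le (d : ℕ) : |((ArithmeticFunction.moebius d : ℤ) : ℝ)| ≤ 1 := by
  rw [← Int.cast_abs]
  exact_mod_cast ArithmeticFunction.abs_moebius_le_one

/-- `G(N)` is bounded (Apostol, Lemma 7.6 with `L(1, χ₄) ≠ 0`). [folklore] -/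
theorem exists_abs_moebiusChiDivSum_le : ∃ C₀ : ℝ, ∀ N : ℕ, |moebiusChiDivSum N| ≤ C₀ := by
  obtain ⟨L₀, hL₀, hA⟩ := exists_chiDivSum_lim
  have hL₀pos : 0 < L₀ := by linarith
  refine ⟨2 / L₀, fun N => ?_⟩
  rcases Nat.eq_zero_or_pos N with rfl | hN
  · simp [moebiusChiDivSum]; positivity
  have key : L₀ * moebiusChiDivSum N =
      1 - ∑ d ∈ Ioc 0 N, (ArithmeticFunction.moebius d : ℝ) * chiDiv d * (chiDivSum (N / d) - L₀) := by
    rw [← sum_moebius_chiDiv_mul_chiDivSum hN, moebiusChiDivSum, Finset.mul_sum,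
      ← Finset.sum_sub_distrib]
    refine Finset.sum_congr rfl fun d _ => ?_
    ring
  have hbound : |∑ d ∈ Ioc 0 N, (ArithmeticFunction.moebius d : ℝ) * chiDiv d *
      (chiDivSum (N / d) - L₀)| ≤ 1 := by
    refine (Finset.abs_sum_le_sum_abs _ _).trans ?_
    have h1 : ∀ d ∈ Ioc 0 N, |(ArithmeticFunction.moebius d : ℝ) * chiDiv d *
        (chiDivSum (N / d) - L₀)| ≤ (N : ℝ)⁻¹ := by
      intro d hd
      have hd0 : 0 < d := (Finset.mem_Ioc.mp hd).1
      rw [abs_mul, abs_mul]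
      calc |(ArithmeticFunction.moebius d : ℝ)| * |chiDiv d| * |chiDivSum (N / d) - L₀|
          ≤ 1 * (d : ℝ)⁻¹ * (((N / d : ℕ) : ℝ) + 1)⁻¹ :=
            mul_le_mul (mul_le_mul (abs_moebius_cast_le d) (abs_chiDiv_le d) (abs_nonneg _)
              zero_le_one) (hA (N / d)) (abs_nonneg _) (by positivity)
        _ ≤ (N : ℝ)⁻¹ := by rw [one_mul]; exact inv_mul_inv_div_add_one_le hd0 hN
    refine (Finset.sum_le_sum h1).trans ?_
    rw [Finset.sum_const, Nat.card_Ioc, Nat.sub_zero, nsmul_eq_mul,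
      mul_inv_cancel₀ (by exact_mod_cast hN.ne')]
  have h2 : |L₀ * moebiusChiDivSum N| ≤ 2 := by
    rw [key]
    calc |1 - _| ≤ |(1 : ℝ)| + |_| := abs_sub _ _
      _ ≤ 1 + 1 := by rw [abs_one]; linarith [hbound]
      _ = 2 := by norm_num
  rw [abs_mul, abs_of_pos hL₀pos] at h2
  rw [le_div_iff₀ hL₀pos, mul_comm]
  exact h2

/-- `∑_{d ≤ N} log d = log N!`. [folklore] -/
theorem sum_Ioc_log_eq_log_factorial (N : ℕ) :
    ∑ d ∈ Ioc 0 N, Real.log d = Real.log (N.factorial) := by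
  induction N with
  | zero => simp
  | succ N ih =>
    rw [Finset.sum_Ioc_succ_top (Nat.zero_le N), ih, Nat.factorial_succ, Nat.cast_mul,
      Real.log_mul (by positivity) (by positivity)]
    push_cast
    ring

/-- A uniform tail bound for `B(K)`: `|B(K) − L₁| ≤ (1 + log(K+1))/(K+1)` for all `K`. [folklore] -/
theorem abs_chiLogDivSum_sub_lim_le {L₁ : ℝ} (hL₁ : |L₁| ≤ Real.log 3 / 3)
    (hB : ∀ N : ℕ, 2 ≤ N → |chiLogDivSum N - L₁| ≤ Real.log ((N : ℝ) + 1) / ((N : ℝ) + 1))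
    (K : ℕ) : |chiLogDivSum K - L₁| ≤ (1 + Real.log ((K : ℝ) + 1)) / ((K : ℝ) + 1) := by
  have hlog3 : Real.log 3 < 1.0986122888 := Real.log_three_lt_d9
  rcases le_or_gt 2 K with hK | hK
  · refine (hB K hK).trans ?_
    gcongr
    linarith
  · have hB0 : chiLogDivSum K = 0 := by
      interval_cases K
      · simp [chiLogDivSum]
      · simp [chiLogDivSum]
    rw [hB0, zero_sub, abs_neg]
    refine hL₁.trans ?_
    have hK1 : (K : ℝ) + 1 ≤ 2 := by
      have : (K : ℝ) ≤ 1 := by exact_mod_cast (show K ≤ 1 by omega)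
      linarith
    have hK0 : (0 : ℝ) < (K : ℝ) + 1 := by positivity
    have hlogK : 0 ≤ Real.log ((K : ℝ) + 1) := Real.log_nonneg (by linarith [(Nat.cast_nonneg K : (0:ℝ) ≤ K)])
    rw [le_div_iff₀ hK0]
    nlinarith

open ArithmeticFunction in
/-- `∑_{n ≤ N} Λ(n) χ₄(n)/n = O(1)` (Apostol, Lemma 7.5 combined with Lemma 7.6). [folklore] -/
theorem exists_abs_sum_vonMangoldt_mul_chiDiv_le :
    ∃ C : ℝ, ∀ N : ℕ, |∑ n ∈ Ioc 0 N, Λ n * chiDiv n| ≤ C := by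
  obtain ⟨C₀, hG⟩ := exists_abs_moebiusChiDivSum_le
  obtain ⟨L₁, hL₁, hB⟩ := exists_chiLogDivSum_lim
  have hU := abs_chiLogDivSum_sub_lim_le hL₁ hB
  refine ⟨Real.log 3 / 3 * C₀ + (2 + Real.log 2), fun N => ?_⟩
  have hC₀ : 0 ≤ C₀ := (abs_nonneg _).trans (hG 0)
  rcases Nat.eq_zero_or_pos N with rfl | hN
  · simp; nlinarith [Real.log_nonneg (show (1:ℝ) ≤ 3 by norm_num), Real.log_nonneg (show (1:ℝ) ≤ 2 by norm_num)]
  have hN' : (0 : ℝ) < N := by exact_mod_cast hN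
  rw [sum_vonMangoldt_mul_chiDiv]
  have key : ∑ d ∈ Ioc 0 N, (μ d : ℝ) * chiDiv d * chiLogDivSum (N / d) =
      L₁ * moebiusChiDivSum N +
        ∑ d ∈ Ioc 0 N, (μ d : ℝ) * chiDiv d * (chiLogDivSum (N / d) - L₁) := by
    rw [moebiusChiDivSum, Finset.mul_sum, ← Finset.sum_add_distrib]
    refine Finset.sum_congr rfl fun d _ => ?_
    ring
  rw [key]
  -- the error sum
  have herr : |∑ d ∈ Ioc 0 N, (μ d : ℝ) * chiDiv d * (chiLogDivSum (N / d) - L₁)| ≤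
      2 + Real.log 2 := by
    refine (Finset.abs_sum_le_sum_abs _ _).trans ?_
    have h1 : ∀ d ∈ Ioc 0 N, |(μ d : ℝ) * chiDiv d * (chiLogDivSum (N / d) - L₁)| ≤
        (N : ℝ)⁻¹ * (1 + Real.log 2 + Real.log N - Real.log d) := by
      intro d hd
      have hd0 : 0 < d := (Finset.mem_Ioc.mp hd).1
      have hdN : d ≤ N := (Finset.mem_Ioc.mp hd).2
      have hd' : (0 : ℝ) < d := by exact_mod_cast hd0
      set K : ℕ := N / d with hK
      have hK1 : 1 ≤ K := (Nat.one_le_div_iff hd0).mpr hdN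
      have hK0 : (0 : ℝ) < (K : ℝ) + 1 := by positivity
      -- `log (K+1) ≤ log 2 + log N − log d`
      have hlogK : Real.log ((K : ℝ) + 1) ≤ Real.log 2 + Real.log N - Real.log d := by
        have hKle : (K : ℝ) ≤ N / d := by rw [hK]; exact Nat.cast_div_le
        have hK1' : (1 : ℝ) ≤ K := by exact_mod_cast hK1
        have h2K : (K : ℝ) + 1 ≤ 2 * (N / d) := by linarith
        calc Real.log ((K : ℝ) + 1) ≤ Real.log (2 * (N / d)) := Real.log_le_log hK0 h2K
          _ = Real.log 2 + Real.log N - Real.log d := by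
              rw [Real.log_mul (by norm_num) (by positivity), Real.log_div (by positivity) hd'.ne']
              ring
      rw [abs_mul, abs_mul]
      calc |(μ d : ℝ)| * |chiDiv d| * |chiLogDivSum K - L₁|
          ≤ 1 * (d : ℝ)⁻¹ * ((1 + Real.log ((K : ℝ) + 1)) / ((K : ℝ) + 1)) :=
            mul_le_mul (mul_le_mul (abs_moebius_cast_le d) (abs_chiDiv_le d) (abs_nonneg _)
              zero_le_one) (hU K) (abs_nonneg _) (by positivity)
        _ = (d : ℝ)⁻¹ * (((K : ℝ) + 1))⁻¹ * (1 + Real.log ((K : ℝ) + 1)) := by ring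
        _ ≤ (N : ℝ)⁻¹ * (1 + Real.log ((K : ℝ) + 1)) := by
            gcongr
            · have : 0 ≤ Real.log ((K : ℝ) + 1) := Real.log_nonneg (by linarith [(Nat.cast_nonneg K : (0:ℝ) ≤ K)])
              linarith
            · exact inv_mul_inv_div_add_one_le hd0 hN
        _ ≤ (N : ℝ)⁻¹ * (1 + Real.log 2 + Real.log N - Real.log d) := by
            gcongr; linarith
    refine (Finset.sum_le_sum h1).trans ?_
    rw [← Finset.mul_sum, Finset.sum_sub_distrib, Finset.sum_const, Nat.card_Ioc, Nat.sub_zero,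
      nsmul_eq_mul, sum_Ioc_log_eq_log_factorial]
    have hfact := Literature.NumberTheory.LFunctions.MertensBound.mul_log_sub_le_log_factorial N
    rw [inv_mul_le_iff₀ hN']
    nlinarith
  calc |L₁ * moebiusChiDivSum N + _| ≤ |L₁ * moebiusChiDivSum N| + |_| := abs_add_le _ _
    _ ≤ Real.log 3 / 3 * C₀ + (2 + Real.log 2) := by
        refine add_le_add ?_ herr
        rw [abs_mul]
        exact mul_le_mul hL₁ (hG N) (abs_nonneg _) (by positivity)

/-! ### From `Λ` to primes: the higher prime powers contribute `O(1)` -/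

open ArithmeticFunction in
/-- `|∑_{n ≤ N, n not prime} Λ(n) χ₄(n)/n| ≤ 2`. [folklore] -/
theorem abs_sum_nonprime_vonMangoldt_chiDiv_le (N : ℕ) :
    |∑ n ∈ (Ioc 0 N).filter (fun n => ¬ n.Prime), Λ n * chiDiv n| ≤ 2 := by
  classical
  set S := (Ioc 0 N).filter (fun n => ¬ n.Prime) with hS
  have h1 : |∑ n ∈ S, Λ n * chiDiv n| ≤ ∑ n ∈ S, Λ n * (n : ℝ)⁻¹ := by
    refine (Finset.abs_sum_le_sum_abs _ _).trans (Finset.sum_le_sum fun n _ => ?_)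
    rw [abs_mul, abs_of_nonneg vonMangoldt_nonneg]
    exact mul_le_mul_of_nonneg_left (abs_chiDiv_le n) vonMangoldt_nonneg
  refine h1.trans ?_
  -- only prime powers contribute
  set Q := S.filter IsPrimePow with hQ
  have h2 : ∑ n ∈ S, Λ n * (n : ℝ)⁻¹ =
      ∑ n ∈ S, (if IsPrimePow n then Real.log n.minFac * (n : ℝ)⁻¹ else 0) := by
    refine Finset.sum_congr rfl fun n _ => ?_
    rw [vonMangoldt_apply]
    split_ifs <;> simp
  rw [h2, ← Finset.sum_filter]
  -- reindex by `n ↦ (minFac n, v(n))`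
  set ι : ℕ → ℕ × ℕ := fun q => (q.minFac, q.factorization q.minFac) with hι
  set g : ℕ × ℕ → ℝ := fun w => Real.log w.1 * ((w.1 : ℝ) ^ w.2)⁻¹ with hg
  have hg0 : ∀ w : ℕ × ℕ, 0 ≤ g w := fun w =>
    mul_nonneg (Real.log_natCast_nonneg _) (by positivity)
  have hmemQ : ∀ q ∈ Q, IsPrimePow q ∧ ¬ q.Prime ∧ 1 ≤ q ∧ q ≤ N := by
    intro q hq
    simp only [hQ, hS, Finset.mem_filter, Finset.mem_Ioc] at hq
    exact ⟨hq.2, hq.1.2, hq.1.1.1, hq.1.1.2⟩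
  have heq : ∀ q ∈ Q, Real.log q.minFac * (q : ℝ)⁻¹ = g (ι q) := by
    intro q hq
    obtain ⟨hpp, -, -, -⟩ := hmemQ q hq
    obtain ⟨-, -, hpow⟩ := Literature.NumberTheory.LFunctions.HallTenenbaum.eq_minFac_pow_of_isPrimePow hpp
    simp only [hg, hι]
    rw [← Nat.cast_pow, hpow]
  have hinj : Set.InjOn ι Q := by
    intro q hq q' hq' h
    obtain ⟨hpp, -, -, -⟩ := hmemQ q hq
    obtain ⟨hpp', -, -, -⟩ := hmemQ q' hq'
    obtain ⟨-, -, hpow⟩ := Literature.NumberTheory.LFunctions.HallTenenbaum.eq_minFac_pow_of_isPrimePow hpp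
    obtain ⟨-, -, hpow'⟩ := Literature.NumberTheory.LFunctions.HallTenenbaum.eq_minFac_pow_of_isPrimePow hpp'
    simp only [hι, Prod.mk.injEq] at h
    rw [← hpow, ← hpow', h.2, h.1]
  have himg : Q.image ι ⊆ Nat.primesLE N ×ˢ Icc 2 N := by
    intro w hw
    obtain ⟨q, hq, rfl⟩ := Finset.mem_image.mp hw
    obtain ⟨hpp, hnp, hq1, hqN⟩ := hmemQ q hq
    obtain ⟨hp, hk1, hpow⟩ := Literature.NumberTheory.LFunctions.HallTenenbaum.eq_minFac_pow_of_isPrimePow hpp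
    set p := q.minFac
    set k := q.factorization q.minFac
    have hk2 : 2 ≤ k := by
      by_contra h
      have hk : k = 1 := by omega
      rw [hk, pow_one] at hpow
      exact hnp (hpow ▸ hp)
    have hpq : p ≤ q := Nat.minFac_le (by omega)
    have hkq : k ≤ q := by
      calc k ≤ 2 ^ k := (Nat.lt_two_pow_self).le
        _ ≤ p ^ k := Nat.pow_le_pow_left hp.two_le k
        _ = q := hpow
    simp only [hι, Finset.mem_product, Nat.mem_primesLE, Finset.mem_Icc]
    exact ⟨⟨hpq.trans hqN, hp⟩, hk2, hkq.trans hqN⟩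
  calc ∑ q ∈ Q, Real.log q.minFac * (q : ℝ)⁻¹ = ∑ q ∈ Q, g (ι q) := Finset.sum_congr rfl heq
    _ = ∑ w ∈ Q.image ι, g w := (Finset.sum_image hinj).symm
    _ ≤ ∑ w ∈ Nat.primesLE N ×ˢ Icc 2 N, g w :=
        Finset.sum_le_sum_of_subset_of_nonneg himg fun w _ _ => hg0 w
    _ = ∑ p ∈ Nat.primesLE N, ∑ k ∈ Icc 2 N, Real.log p * ((p : ℝ) ^ k)⁻¹ := by
        rw [Finset.sum_product]
    _ ≤ ∑ p ∈ Nat.primesLE N, Real.log p / (p * (p - 1)) := by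
        refine Finset.sum_le_sum fun p hp => ?_
        have hpp := (Nat.mem_primesLE.mp hp).2
        have hp1 : (1 : ℝ) < p := by exact_mod_cast hpp.one_lt
        have hp0 : (0 : ℝ) < p := by linarith
        rw [← Finset.mul_sum, div_eq_mul_inv]
        refine mul_le_mul_of_nonneg_left ?_ (Real.log_nonneg hp1.le)
        have hgeom : ∑ k ∈ Icc 2 N, ((p : ℝ) ^ k)⁻¹ ≤ ((p : ℝ)⁻¹) ^ 2 / (1 - (p : ℝ)⁻¹) := by
          have := geom_sum_Ico_le_of_lt_one (x := (p : ℝ)⁻¹) (m := 2) (n := N + 1)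
            (by positivity) (inv_lt_one_of_one_lt₀ hp1)
          rw [show Icc 2 N = Ico 2 (N + 1) from rfl] 
          refine le_trans (le_of_eq (Finset.sum_congr rfl fun k _ => by rw [inv_pow])) this
        refine hgeom.trans (le_of_eq ?_)
        have : (p : ℝ) - 1 ≠ 0 := by linarith
        field_simp
    _ ≤ 2 := Literature.NumberTheory.LFunctions.MertensBound.sum_log_div_mul_pred_le_two N

/-! ### Mertens' first theorem for `χ₄` and for `ρ` -/

open ArithmeticFunction in
/-- **`∑_{p ≤ N} χ₄(p) log p / p = O(1)`** (Mertens' theorem for the non-principal character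
mod 4; Apostol, Theorem 7.3 with Lemmas 7.5–7.6 and `L(1, χ₄) > 0`). [folklore] -/
theorem exists_abs_sum_chi4R_log_div_le :
    ∃ C₁ : ℝ, ∀ N : ℕ, |∑ p ∈ Nat.primesLE N, chi4R p * Real.log p / p| ≤ C₁ := by
  obtain ⟨C, hC⟩ := exists_abs_sum_vonMangoldt_mul_chiDiv_le
  refine ⟨C + 2, fun N => ?_⟩
  have hsplit := Finset.sum_filter_add_sum_filter_not (Ioc 0 N) (fun n => n.Prime)
    (fun n => Λ n * chiDiv n)
  have hprime : ∑ n ∈ (Ioc 0 N).filter (fun n => n.Prime), Λ n * chiDiv n =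
      ∑ p ∈ Nat.primesLE N, chi4R p * Real.log p / p := by
    have hset : (Ioc 0 N).filter (fun n => n.Prime) = Nat.primesLE N := by
      ext p
      simp only [Finset.mem_filter, Finset.mem_Ioc, Nat.mem_primesLE]
      exact ⟨fun ⟨⟨_, h2⟩, h3⟩ => ⟨h2, h3⟩, fun ⟨h2, h3⟩ => ⟨⟨h3.pos, h2⟩, h3⟩⟩
    rw [hset]
    refine Finset.sum_congr rfl fun p hp => ?_
    rw [vonMangoldt_apply_prime (Nat.mem_primesLE.mp hp).2, chiDiv]
    ring
  rw [← hprime, ← sub_eq_of_eq_add hsplit.symm]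
  calc |_ - _| ≤ |_| + |_| := abs_sub _ _
    _ ≤ C + 2 := add_le_add (hC N) (abs_sum_nonprime_vonMangoldt_chiDiv_le N)

/-- `ρ(p) = 1 + χ₄(p)` for every prime `p` (for `p = 2`: `ρ(2) = 1`, `χ₄(2) = 0`). [folklore] -/
theorem rho_prime_eq_one_add_chi4R {p : ℕ} (hp : p.Prime) : (rho p : ℝ) = 1 + chi4R p := by
  by_cases h2 : p = 2
  · subst h2
    rw [show rho 2 = 1 by decide, show chi4R 2 = 0 by rw [chi4R_eq_ite]; norm_num]
    norm_num
  · have h := fiRho_prime hp h2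
    have hr : rho p = fiRho p := rfl
    have h' : ((fiRho p : ℤ) : ℝ) = ((1 + ZMod.χ₄ p : ℤ) : ℝ) := by rw [h]
    push_cast at h'
    rw [hr, h']
    rfl

/-- `R(t) = ∑_{p ≤ t} ρ(p) log p / p`. [folklore] -/
def rhoLogSum (t : ℝ) : ℝ := ∑ p ∈ Nat.primesLE ⌊t⌋₊, (rho p : ℝ) * Real.log p / p

/-- Mertens' first theorem for `ρ`: `∑_{p ≤ t} ρ(p) log p / p = log t + O(1)` (`t ≥ 1`). [folklore] -/
def RhoMertensStrong : Prop := ∃ C : ℝ, ∀ t : ℝ, 1 ≤ t → |rhoLogSum t - Real.log t| ≤ C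

/-- **Mertens' first theorem for `ρ` — PROVED**; the discharge `<Fact>_holds` of the named fact
`RhoMertensStrong` (called `rhoMertensStrong_holds` before 2026-08-15). [folklore] -/
theorem RhoMertensStrong_holds : RhoMertensStrong := by
  obtain ⟨C₁, hC₁⟩ := exists_abs_sum_chi4R_log_div_le
  refine ⟨4 + C₁, fun t ht => ?_⟩
  have hM := Literature.NumberTheory.LFunctions.MertensBound.sum_log_div_prime_bounds ht
  have hdec : rhoLogSum t = ∑ p ∈ Nat.primesLE ⌊t⌋₊, Real.log p / p +
      ∑ p ∈ Nat.primesLE ⌊t⌋₊, chi4R p * Real.log p / p := by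
    rw [rhoLogSum, ← Finset.sum_add_distrib]
    refine Finset.sum_congr rfl fun p hp => ?_
    rw [rho_prime_eq_one_add_chi4R (Nat.mem_primesLE.mp hp).2]
    ring
  have h := hC₁ ⌊t⌋₊
  rw [abs_le] at h ⊢
  rw [hdec]
  constructor <;> linarith [h.1, h.2, hM.1, hM.2]


/-! ### From Mertens I for `ρ` to condition (1) of Lemma 2 -/


/-- The prime-indicator form of `R(m)` used with Mathlib's Abel summation. [folklore] -/
theorem sum_Icc_ite_prime_rho_log_div (m : ℕ) :
    ∑ k ∈ Icc 0 m, (if k.Prime then (rho k : ℝ) * Real.log k / k else 0) =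
      ∑ p ∈ Nat.primesLE m, (rho p : ℝ) * Real.log p / p := by
  rw [Nat.primesLE_eq_filter_range, Finset.sum_filter, Nat.range_succ_eq_Icc_zero]

/-- Tail upper bound: `∑_{P < p ≤ Q} ρ(p)/p ≤ log log Q − log log P + 2C / log P`. [folklore] -/
theorem sum_Ioc_rho_div_le {C : ℝ} (hC : ∀ t : ℝ, 1 ≤ t → |rhoLogSum t - Real.log t| ≤ C)
    {P Q : ℝ} (hP : 2 ≤ P) (hPQ : P ≤ Q) :
    ∑ p ∈ (Ioc ⌊P⌋₊ ⌊Q⌋₊).filter Nat.Prime, (rho p : ℝ) / p ≤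
      Real.log (Real.log Q) - Real.log (Real.log P) + 2 * C / Real.log P := by
  have hP0 : (0 : ℝ) ≤ P := by linarith
  have hQ : 2 ≤ Q := hP.trans hPQ
  set c : ℕ → ℝ := fun k => if k.Prime then (rho k : ℝ) * Real.log k / k else 0 with hc
  set f : ℝ → ℝ := fun t => (Real.log t)⁻¹ with hf
  set g : ℝ → ℝ := fun t => -t⁻¹ / Real.log t ^ 2 with hg
  have hderiv : ∀ t : ℝ, 1 < t → HasDerivAt f (g t) t := by
    intro t ht
    exact (Real.hasDerivAt_log (show t ≠ 0 by linarith)).inv (Real.log_pos ht).ne'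
  have hmem : ∀ t ∈ Set.Icc P Q, t ∈ ({0}ᶜ : Set ℝ) := fun t ht =>
    Set.mem_compl_singleton_iff.mpr (show (0 : ℝ) < t by linarith [ht.1]).ne'
  have hlogne : ∀ t ∈ Set.Icc P Q, Real.log t ≠ 0 := fun t ht =>
    (Real.log_pos (by linarith [ht.1])).ne'
  have hgcont : ContinuousOn g (Set.Icc P Q) :=
    ContinuousOn.div (ContinuousOn.neg (continuousOn_inv₀.mono hmem))
      ((Real.continuousOn_log.mono hmem).pow 2) fun t ht => pow_ne_zero _ (hlogne t ht)
  have hf_diff : ∀ t ∈ Set.Icc P Q, DifferentiableAt ℝ f t := fun t ht =>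
    (hderiv t (by linarith [ht.1])).differentiableAt
  have hderiv_eq : Set.EqOn g (deriv f) (Set.Icc P Q) := fun t ht =>
    ((hderiv t (by linarith [ht.1])).deriv).symm
  have hg_int : IntegrableOn g (Set.Icc P Q) := hgcont.integrableOn_Icc
  have hf_int : IntegrableOn (deriv f) (Set.Icc P Q) :=
    hg_int.congr_fun hderiv_eq measurableSet_Icc
  -- Abel summation
  have habel := sum_mul_eq_sub_sub_integral_mul c hP0 hPQ hf_diff hf_int
  have hlhs : ∑ k ∈ Ioc ⌊P⌋₊ ⌊Q⌋₊, f k * c k =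
      ∑ p ∈ (Ioc ⌊P⌋₊ ⌊Q⌋₊).filter Nat.Prime, (rho p : ℝ) / p := by
    rw [Finset.sum_filter]
    refine Finset.sum_congr rfl fun k _ => ?_
    simp only [hc]
    split_ifs with hk
    · have hk1 : (1 : ℝ) < k := by exact_mod_cast hk.one_lt
      have : Real.log k ≠ 0 := (Real.log_pos hk1).ne'
      show (Real.log k)⁻¹ * ((rho k : ℝ) * Real.log k / k) = (rho k : ℝ) / k
      field_simp
    · simp
  -- the partial sums
  have hS : ∀ t : ℝ, 1 ≤ t →
      Real.log t - C ≤ ∑ k ∈ Icc 0 ⌊t⌋₊, c k ∧ ∑ k ∈ Icc 0 ⌊t⌋₊, c k ≤ Real.log t + C := by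
    intro t ht
    rw [hc, sum_Icc_ite_prime_rho_log_div]
    have h := hC t ht
    rw [rhoLogSum, abs_le] at h
    constructor <;> linarith [h.1, h.2]
  have hlogP : 0 < Real.log P := Real.log_pos (by linarith)
  have hlogQ : 0 < Real.log Q := Real.log_pos (by linarith)
  -- boundary terms
  have hbQ : f Q * ∑ k ∈ Icc 0 ⌊Q⌋₊, c k ≤ 1 + C / Real.log Q := by
    have := (hS Q (by linarith)).2
    calc f Q * ∑ k ∈ Icc 0 ⌊Q⌋₊, c k ≤ (Real.log Q)⁻¹ * (Real.log Q + C) :=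
          mul_le_mul_of_nonneg_left this (inv_nonneg.mpr hlogQ.le)
      _ = 1 + C / Real.log Q := by field_simp
  have hbP : 1 - C / Real.log P ≤ f P * ∑ k ∈ Icc 0 ⌊P⌋₊, c k := by
    have := (hS P (by linarith)).1
    calc 1 - C / Real.log P = (Real.log P)⁻¹ * (Real.log P - C) := by field_simp
      _ ≤ (Real.log P)⁻¹ * ∑ k ∈ Icc 0 ⌊P⌋₊, c k :=
          mul_le_mul_of_nonneg_left this (inv_nonneg.mpr hlogP.le)
  -- the integral term
  have hint : -∫ t in Set.Ioc P Q, deriv f t * ∑ k ∈ Icc 0 ⌊t⌋₊, c k ≤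
      Real.log (Real.log Q) - C / Real.log Q - (Real.log (Real.log P) - C / Real.log P) := by
    have h1 : ∫ t in Set.Ioc P Q, deriv f t * ∑ k ∈ Icc 0 ⌊t⌋₊, c k =
        ∫ t in Set.Ioc P Q, g t * ∑ k ∈ Icc 0 ⌊t⌋₊, c k := by
      refine setIntegral_congr_fun measurableSet_Ioc fun t ht => ?_
      rw [hderiv_eq (Set.Ioc_subset_Icc_self ht)]
    rw [h1, ← integral_neg]
    set F : ℝ → ℝ := fun t => Real.log (Real.log t) - C * (Real.log t)⁻¹ with hF
    set w : ℝ → ℝ := fun t => t⁻¹ / Real.log t ^ 2 * (Real.log t + C) with hw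
    have hFderiv : ∀ t : ℝ, 1 < t → HasDerivAt F (w t) t := by
      intro t ht
      have ht0 : t ≠ 0 := by linarith
      have hl : Real.log t ≠ 0 := (Real.log_pos ht).ne'
      have hA := (Real.hasDerivAt_log ht0).log hl
      have hB := ((Real.hasDerivAt_log ht0).inv hl).const_mul C
      have heq : t⁻¹ / Real.log t - C * (-t⁻¹ / Real.log t ^ 2) = w t := by
        simp only [hw]
        field_simp
        ring
      exact (hA.sub hB).congr_deriv heq
    have hwcont : ContinuousOn w (Set.Icc P Q) :=
      ContinuousOn.mul (ContinuousOn.div (continuousOn_inv₀.mono hmem)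
        ((Real.continuousOn_log.mono hmem).pow 2) fun t ht => pow_ne_zero _ (hlogne t ht))
        ((Real.continuousOn_log.mono hmem).add continuousOn_const)
    have hFTC : ∫ t in Set.Ioc P Q, w t = F Q - F P := by
      rw [← intervalIntegral.integral_of_le hPQ]
      refine intervalIntegral.integral_eq_sub_of_hasDerivAt (fun t ht => hFderiv t ?_)
        (hwcont.mono ?_).intervalIntegrable
      · rw [Set.uIcc_of_le hPQ] at ht; linarith [ht.1]
      · rw [Set.uIcc_of_le hPQ]
    have hFQP : F Q - F P =
        Real.log (Real.log Q) - C / Real.log Q - (Real.log (Real.log P) - C / Real.log P) := by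
      simp only [hF, div_eq_mul_inv]
    rw [← hFQP, ← hFTC]
    have hint1 : IntegrableOn w (Set.Ioc P Q) :=
      hwcont.integrableOn_Icc.mono_set Set.Ioc_subset_Icc_self
    have hint2 : IntegrableOn (fun t => -(g t * ∑ k ∈ Icc 0 ⌊t⌋₊, c k)) (Set.Ioc P Q) :=
      ((integrableOn_mul_sum_Icc c hP0 hg_int).mono_set Set.Ioc_subset_Icc_self).neg
    refine setIntegral_mono_on hint2 hint1 measurableSet_Ioc fun t ht => ?_
    have ht1 : 1 < t := by linarith [ht.1]
    have hpos : 0 ≤ t⁻¹ / Real.log t ^ 2 := by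
      have : 0 < t := by linarith
      positivity
    have := (hS t ht1.le).2
    calc -(g t * ∑ k ∈ Icc 0 ⌊t⌋₊, c k) = t⁻¹ / Real.log t ^ 2 * ∑ k ∈ Icc 0 ⌊t⌋₊, c k := by
          simp only [hg]; ring
      _ ≤ t⁻¹ / Real.log t ^ 2 * (Real.log t + C) := mul_le_mul_of_nonneg_left this hpos
      _ = w t := rfl
  rw [← hlhs, habel]
  have hCQ : 0 ≤ C / Real.log Q := by
    have h0 : 0 ≤ C := by
      have := hC 1 le_rfl
      exact (abs_nonneg _).trans this
    positivity
  have e1 : 2 * C / Real.log P = C / Real.log P + C / Real.log P := by ring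
  linarith

/-- `ρ(2) = 1`. [folklore] -/
theorem rho_two : rho 2 = 1 := by decide

/-- The primes `w ≤ p < z` inside `(⌊w − 1⌋, ⌊z⌋]`. [folklore] -/
theorem primesBelow_filter_subset {w z : ℝ} (hw : 1 ≤ w) :
    (Nat.primesBelow ⌈z⌉₊).filter (fun p : ℕ => w ≤ (p : ℝ)) ⊆
      (Ioc ⌊w - 1⌋₊ ⌊z⌋₊).filter Nat.Prime := by
  intro p hp
  simp only [Finset.mem_filter, Nat.mem_primesBelow, Finset.mem_Ioc] at hp ⊢
  obtain ⟨⟨hpz, hpp⟩, hwp⟩ := hp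
  refine ⟨⟨?_, ?_⟩, hpp⟩
  · have h1 : (⌊w - 1⌋₊ : ℝ) ≤ w - 1 := Nat.floor_le (by linarith)
    have h2 : (⌊w - 1⌋₊ : ℝ) < p := by linarith
    exact_mod_cast h2
  · have := Nat.ceil_le_floor_add_one z
    omega

/-- `∑_{w ≤ p < z} ρ(p)/p ≤ log(log z / log w) + C₂ / log w` for `2 ≤ w < z`. [folklore] -/
theorem sum_rho_div_filter_le {C : ℝ} (hC : ∀ t : ℝ, 1 ≤ t → |rhoLogSum t - Real.log t| ≤ C)
    {w z : ℝ} (hw : 2 ≤ w) (hwz : w < z) :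
    ∑ p ∈ (Nat.primesBelow ⌈z⌉₊).filter (fun p : ℕ => w ≤ (p : ℝ)), (rho p : ℝ) / p ≤
      Real.log (Real.log z / Real.log w) + (5 + 12 * C) / Real.log w := by
  have hC0 : 0 ≤ C := by
    have := hC 1 le_rfl
    exact (abs_nonneg _).trans this
  have hz2 : 2 < z := by linarith
  have hlogw : 0 < Real.log w := Real.log_pos (by linarith)
  have hlogz : 0 < Real.log z := Real.log_pos (by linarith)
  have hnonneg : ∀ p ∈ (Ioc ⌊w - 1⌋₊ ⌊z⌋₊).filter Nat.Prime, (0 : ℝ) ≤ (rho p : ℝ) / p :=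
    fun p _ => by positivity
  rw [Real.log_div hlogz.ne' hlogw.ne']
  by_cases h3 : 3 ≤ w
  · -- `w ≥ 3`: compare with the tail over `(w − 1, z]`
    have hsub := primesBelow_filter_subset (z := z) (show (1 : ℝ) ≤ w by linarith)
    have h1 : (2 : ℝ) ≤ w - 1 := by linarith
    have hmain := sum_Ioc_rho_div_le hC h1 (by linarith : w - 1 ≤ z)
    have hfl : ⌊w - 1⌋₊ = ⌊w - 1⌋₊ := rfl
    have hle := (Finset.sum_le_sum_of_subset_of_nonneg hsub fun p hp _ => hnonneg p hp).trans hmain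
    -- `log log w − log log (w−1) ≤ (1/2)/log(w−1)` and `1/log(w−1) ≤ 2/log w`
    have hlw1 : 0 < Real.log (w - 1) := Real.log_pos (by linarith)
    have hA : Real.log (Real.log w) - Real.log (Real.log (w - 1)) ≤ (1 / 2) / Real.log (w - 1) := by
      rw [← Real.log_div hlogw.ne' hlw1.ne']
      have h := Real.log_le_sub_one_of_pos (div_pos hlogw hlw1)
      have h2 : Real.log w / Real.log (w - 1) - 1 = (Real.log w - Real.log (w - 1)) / Real.log (w - 1) := by
        field_simp
      have h3' : Real.log w - Real.log (w - 1) ≤ 1 / 2 := by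
        rw [← Real.log_div (by linarith) (by linarith)]
        have := Real.log_le_sub_one_of_pos (show 0 < w / (w - 1) by positivity)
        have h4 : w / (w - 1) - 1 = 1 / (w - 1) := by field_simp; ring
        rw [h4] at this
        calc Real.log (w / (w - 1)) ≤ 1 / (w - 1) := this
          _ ≤ 1 / 2 := by
            rw [div_le_div_iff₀ (by linarith) (by norm_num)]; linarith
      calc Real.log (Real.log w / Real.log (w - 1)) ≤ Real.log w / Real.log (w - 1) - 1 := h
        _ = (Real.log w - Real.log (w - 1)) / Real.log (w - 1) := h2
        _ ≤ (1 / 2) / Real.log (w - 1) := by gcongr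
    have hB : 1 / Real.log (w - 1) ≤ 2 / Real.log w := by
      -- `log w ≤ 2 log (w − 1)` since `w ≤ (w−1)²`
      have h5 : Real.log w ≤ 2 * Real.log (w - 1) := by
        rw [← Real.log_rpow (by linarith), show ((w - 1) ^ (2 : ℝ)) = (w - 1) ^ 2 by norm_cast]
        exact Real.log_le_log (by linarith) (by nlinarith)
      rw [div_le_div_iff₀ hlw1 hlogw]
      linarith
    have hB' : 0 < 1 / Real.log (w - 1) := by positivity
    calc ∑ p ∈ (Nat.primesBelow ⌈z⌉₊).filter (fun p : ℕ => w ≤ (p : ℝ)), (rho p : ℝ) / p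
        ≤ Real.log (Real.log z) - Real.log (Real.log (w - 1)) + 2 * C / Real.log (w - 1) := hle
      _ ≤ Real.log (Real.log z) - Real.log (Real.log w) + (1 / 2 + 2 * C) * (1 / Real.log (w - 1)) := by
          have e1 : 2 * C / Real.log (w - 1) = 2 * C * (1 / Real.log (w - 1)) := by ring
          have e2 : 1 / 2 / Real.log (w - 1) = (1 / 2) * (1 / Real.log (w - 1)) := by ring
          rw [e1] at hle; rw [e2] at hA
          nlinarith
      _ ≤ Real.log (Real.log z) - Real.log (Real.log w) + (1 / 2 + 2 * C) * (2 / Real.log w) := by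
          gcongr
      _ ≤ Real.log (Real.log z) - Real.log (Real.log w) + (5 + 12 * C) / Real.log w := by
          rw [mul_div_assoc']
          gcongr
          linarith
  · -- `2 ≤ w < 3`: the whole range `2 ≤ p < z`
    push Not at h3
    have hfl2 : ⌊(2 : ℝ)⌋₊ = 2 := by norm_num
    have hsub : (Nat.primesBelow ⌈z⌉₊).filter (fun p : ℕ => w ≤ (p : ℝ)) ⊆
        insert 2 ((Ioc ⌊(2 : ℝ)⌋₊ ⌊z⌋₊).filter Nat.Prime) := by
      intro p hp
      simp only [Finset.mem_filter, Nat.mem_primesBelow, Finset.mem_insert, Finset.mem_Ioc] at hp ⊢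
      obtain ⟨⟨hpz, hpp⟩, hwp⟩ := hp
      rcases hpp.two_le.eq_or_lt with h | h
      · exact Or.inl h.symm
      · refine Or.inr ⟨⟨?_, ?_⟩, hpp⟩
        · rw [hfl2]; exact h
        · have := Nat.ceil_le_floor_add_one z; omega
    have hmain := sum_Ioc_rho_div_le hC (le_refl (2 : ℝ)) hz2.le
    have h2notin : (2 : ℕ) ∉ (Ioc ⌊(2 : ℝ)⌋₊ ⌊z⌋₊).filter Nat.Prime := by
      rw [hfl2]; simp
    have hnonneg' : ∀ p ∈ insert 2 ((Ioc ⌊(2 : ℝ)⌋₊ ⌊z⌋₊).filter Nat.Prime),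
        (0 : ℝ) ≤ (rho p : ℝ) / p := fun p _ => by positivity
    have hle : ∑ p ∈ (Nat.primesBelow ⌈z⌉₊).filter (fun p : ℕ => w ≤ (p : ℝ)), (rho p : ℝ) / p ≤
        1 / 2 + (Real.log (Real.log z) - Real.log (Real.log 2) + 2 * C / Real.log 2) := by
      calc ∑ p ∈ (Nat.primesBelow ⌈z⌉₊).filter (fun p : ℕ => w ≤ (p : ℝ)), (rho p : ℝ) / p
          ≤ ∑ p ∈ insert 2 ((Ioc ⌊(2 : ℝ)⌋₊ ⌊z⌋₊).filter Nat.Prime), (rho p : ℝ) / p :=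
            Finset.sum_le_sum_of_subset_of_nonneg hsub fun p hp _ => hnonneg' p hp
        _ = (rho 2 : ℝ) / 2 + ∑ p ∈ (Ioc ⌊(2 : ℝ)⌋₊ ⌊z⌋₊).filter Nat.Prime, (rho p : ℝ) / p := by
            rw [Finset.sum_insert h2notin]; push_cast; ring
        _ ≤ 1 / 2 + (Real.log (Real.log z) - Real.log (Real.log 2) + 2 * C / Real.log 2) := by
            rw [rho_two]; push_cast; linarith
    -- numerical facts
    have hlog2 : 1 / 2 < Real.log 2 := by have := Real.log_two_gt_d9; linarith
    have hlog2' : 0 < Real.log 2 := by linarith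
    have hlog3le : Real.log 3 ≤ 2 := by
      have := Real.log_le_sub_one_of_pos (show (0 : ℝ) < 3 by norm_num); linarith
    have hlog3 : 0 < Real.log 3 := Real.log_pos (by norm_num)
    have hlogw3 : Real.log w < Real.log 3 := Real.log_lt_log (by linarith) h3
    have hll : Real.log (Real.log w) < Real.log (Real.log 3) := Real.log_lt_log hlogw hlogw3
    have h32 : Real.log (Real.log 3) - Real.log (Real.log 2) ≤ 2 := by
      rw [← Real.log_div hlog3.ne' hlog2'.ne']
      have h := Real.log_le_sub_one_of_pos (div_pos hlog3 hlog2')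
      have h' : Real.log 3 / Real.log 2 ≤ 3 := by
        rw [div_le_iff₀ hlog2']
        have : Real.log 3 ≤ Real.log 8 := Real.log_le_log (by norm_num) (by norm_num)
        have h8 : Real.log 8 = 3 * Real.log 2 := by
          rw [show (8 : ℝ) = 2 ^ 3 by norm_num, Real.log_pow]; push_cast; ring
        linarith
      linarith
    have hCw : (5 + 12 * C) / 2 ≤ (5 + 12 * C) / Real.log w := by
      apply div_le_div_of_nonneg_left (by linarith) hlogw
      linarith
    have hC2 : 2 * C / Real.log 2 ≤ 4 * C := by
      rw [div_le_iff₀ hlog2']; nlinarith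
    linarith

/-- `−log(1 − t) ≤ t + 2t²` for `t ≤ 1/2`, in the form `(1 − t)⁻¹ ≤ exp(t + 2 t²)`. [folklore] -/
theorem inv_one_sub_le_exp {t : ℝ} (h1 : t ≤ 1 / 2) :
    (1 - t)⁻¹ ≤ Real.exp (t + 2 * t ^ 2) := by
  have hpos : 0 < 1 - t := by linarith
  rw [← Real.exp_log (inv_pos.mpr hpos), Real.exp_le_exp]
  have h := Real.log_le_sub_one_of_pos (inv_pos.mpr hpos)
  have h2 : (1 - t)⁻¹ - 1 = t / (1 - t) := by field_simp; ring
  rw [h2] at h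
  refine h.trans ?_
  rw [div_le_iff₀ hpos]
  nlinarith

/-- `ρ(p)/p ≤ 1/2` for every prime `p`. [folklore] -/
theorem rho_div_le_half {p : ℕ} (hp : p.Prime) : (rho p : ℝ) / p ≤ 1 / 2 := by
  have hp0 : (0 : ℝ) < p := by exact_mod_cast hp.pos
  rw [div_le_iff₀ hp0]
  rcases hp.two_le.eq_or_lt with h | h
  · subst h; rw [rho_two]; norm_num
  · -- `p ≥ 3`: `ρ(3) = 0`, and `ρ(p) ≤ 2 ≤ p/2` for `p ≥ 4`
    rcases (show 3 ≤ p from h).eq_or_lt with h3 | h4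
    · subst h3; rw [show rho 3 = 0 by decide]; norm_num
    · have h2 := rho_le_two hp
      have : (rho p : ℝ) ≤ 2 := by exact_mod_cast h2
      have : (4 : ℝ) ≤ p := by exact_mod_cast h4
      linarith

/-- `∑_{w ≤ p < z} (ρ(p)/p)² ≤ 8 / w` for `w ≥ 2`. [folklore] -/
theorem sum_rho_div_sq_le {w z : ℝ} (hw : 2 ≤ w) :
    ∑ p ∈ (Nat.primesBelow ⌈z⌉₊).filter (fun p : ℕ => w ≤ (p : ℝ)), ((rho p : ℝ) / p) ^ 2 ≤
      8 / w := by
  set k : ℕ := ⌈w⌉₊ - 1 with hk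
  have hceil : 1 ≤ ⌈w⌉₊ := Nat.one_le_iff_ne_zero.mpr (Nat.ceil_pos.mpr (by linarith)).ne'
  set S := (Nat.primesBelow ⌈z⌉₊).filter (fun p : ℕ => w ≤ (p : ℝ)) with hS
  have hsub : S ⊆ Ioo k ⌈z⌉₊ := by
    intro p hp
    simp only [hS, Finset.mem_filter, Nat.mem_primesBelow, Finset.mem_Ioo] at hp ⊢
    obtain ⟨⟨hpz, hpp⟩, hwp⟩ := hp
    refine ⟨?_, hpz⟩
    have : ⌈w⌉₊ ≤ p := Nat.ceil_le.mpr hwp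
    omega
  have h1 : ∀ p ∈ S, ((rho p : ℝ) / p) ^ 2 ≤ 4 * ((p : ℝ) ^ 2)⁻¹ := by
    intro p hp
    have hpp : p.Prime := (Nat.mem_primesBelow.mp (Finset.mem_filter.mp hp).1).2
    have h2 : (rho p : ℝ) ≤ 2 := by exact_mod_cast rho_le_two hpp
    have hp0 : (0 : ℝ) < p := by exact_mod_cast hpp.pos
    rw [div_pow, div_eq_mul_inv]
    gcongr
    have h0 : (0 : ℝ) ≤ rho p := Nat.cast_nonneg _
    nlinarith
  calc ∑ p ∈ S, ((rho p : ℝ) / p) ^ 2 ≤ ∑ p ∈ S, 4 * ((p : ℝ) ^ 2)⁻¹ := Finset.sum_le_sum h1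
    _ ≤ ∑ i ∈ Ioo k ⌈z⌉₊, 4 * ((i : ℝ) ^ 2)⁻¹ :=
        Finset.sum_le_sum_of_subset_of_nonneg hsub fun i _ _ => by positivity
    _ = 4 * ∑ i ∈ Ioo k ⌈z⌉₊, ((i : ℝ) ^ 2)⁻¹ := by rw [Finset.mul_sum]
    _ ≤ 4 * (2 / (k + 1)) := by gcongr; exact sum_Ioo_inv_sq_le k ⌈z⌉₊
    _ = 8 / (⌈w⌉₊ : ℝ) := by
        rw [hk, Nat.cast_sub hceil]; push_cast; ring
    _ ≤ 8 / w := div_le_div_of_nonneg_left (by norm_num) (by linarith) (Nat.le_ceil w)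

/-- `exp u ≤ 1 + u exp u`. [folklore] -/
theorem exp_le_one_add_mul_exp (u : ℝ) : Real.exp u ≤ 1 + u * Real.exp u := by
  have h := Real.add_one_le_exp (-u)
  have he : 0 < Real.exp u := Real.exp_pos u
  have : (-u + 1) * Real.exp u ≤ Real.exp (-u) * Real.exp u :=
    mul_le_mul_of_nonneg_right h he.le
  rw [← Real.exp_add, neg_add_cancel, Real.exp_zero] at this
  nlinarith

/-- **Condition (1) of Lemma 2 for `ω = ρ`** from Mertens I for `ρ`: there is `K ≥ 1` with
`∏_{w ≤ p < z} (1 − ρ(p)/p)⁻¹ ≤ (log z / log w)(1 + K / log w)` for all `2 ≤ w < z`. [folklore] -/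
theorem prod_inv_one_sub_rho_div_le {C : ℝ}
    (hC : ∀ t : ℝ, 1 ≤ t → |rhoLogSum t - Real.log t| ≤ C) :
    ∃ K : ℝ, 1 ≤ K ∧ ∀ w z : ℝ, 2 ≤ w → w < z →
      ∏ p ∈ (Nat.primesBelow ⌈z⌉₊).filter (fun p : ℕ => w ≤ (p : ℝ)), (1 - (rho p : ℝ) / p)⁻¹ ≤
        Real.log z / Real.log w * (1 + K / Real.log w) := by
  have hC0 : 0 ≤ C := by
    have := hC 1 le_rfl
    exact (abs_nonneg _).trans this
  set C₃ : ℝ := 5 + 12 * C + 16 with hC₃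
  have hC₃0 : 0 ≤ C₃ := by rw [hC₃]; linarith
  have hlog2 : 0 < Real.log 2 := Real.log_pos (by norm_num)
  refine ⟨C₃ * Real.exp (C₃ / Real.log 2), ?_, ?_⟩
  · have h1 : (1 : ℝ) ≤ Real.exp (C₃ / Real.log 2) := Real.one_le_exp (by positivity)
    have h16 : (16 : ℝ) ≤ C₃ := by rw [hC₃]; linarith
    nlinarith
  intro w z hw hwz
  set S := (Nat.primesBelow ⌈z⌉₊).filter (fun p : ℕ => w ≤ (p : ℝ)) with hS
  have hlogw : 0 < Real.log w := Real.log_pos (by linarith)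
  have hlogz : 0 < Real.log z := Real.log_pos (by linarith)
  have hlogw2 : Real.log 2 ≤ Real.log w := Real.log_le_log (by norm_num) hw
  have hmemS : ∀ p ∈ S, p.Prime := fun p hp =>
    (Nat.mem_primesBelow.mp (Finset.mem_filter.mp hp).1).2
  -- each factor is at most `exp(t + 2t²)`
  have hfac : ∀ p ∈ S, (1 - (rho p : ℝ) / p)⁻¹ ≤
      Real.exp ((rho p : ℝ) / p + 2 * ((rho p : ℝ) / p) ^ 2) := fun p hp =>
    inv_one_sub_le_exp (rho_div_le_half (hmemS p hp))
  have hnn : ∀ p ∈ S, 0 ≤ (1 - (rho p : ℝ) / p)⁻¹ := fun p hp => by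
    have := rho_div_le_half (hmemS p hp)
    exact inv_nonneg.mpr (by linarith)
  have h1 : ∏ p ∈ S, (1 - (rho p : ℝ) / p)⁻¹ ≤
      Real.exp (∑ p ∈ S, ((rho p : ℝ) / p + 2 * ((rho p : ℝ) / p) ^ 2)) := by
    rw [Real.exp_sum]
    exact Finset.prod_le_prod hnn hfac
  have h2 : ∑ p ∈ S, ((rho p : ℝ) / p + 2 * ((rho p : ℝ) / p) ^ 2) ≤
      Real.log (Real.log z / Real.log w) + C₃ / Real.log w := by
    rw [Finset.sum_add_distrib, ← Finset.mul_sum]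
    have hA := sum_rho_div_filter_le hC hw hwz
    have hB := sum_rho_div_sq_le (z := z) hw
    have hw0 : 0 < w := by linarith
    have hlw : Real.log w ≤ w := by
      have := Real.log_le_sub_one_of_pos hw0; linarith
    have h16 : 2 * (8 / w) ≤ 16 / Real.log w := by
      rw [show 2 * (8 / w) = 16 / w by ring]
      exact div_le_div_of_nonneg_left (by norm_num) hlogw hlw
    have : (5 + 12 * C) / Real.log w + 16 / Real.log w = C₃ / Real.log w := by
      rw [hC₃]; ring
    linarith
  have h3 : Real.exp (Real.log (Real.log z / Real.log w) + C₃ / Real.log w) =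
      Real.log z / Real.log w * Real.exp (C₃ / Real.log w) := by
    rw [Real.exp_add, Real.exp_log (div_pos hlogz hlogw)]
  have h4 : Real.exp (C₃ / Real.log w) ≤ 1 + C₃ * Real.exp (C₃ / Real.log 2) / Real.log w := by
    have hu := exp_le_one_add_mul_exp (C₃ / Real.log w)
    have hmono : Real.exp (C₃ / Real.log w) ≤ Real.exp (C₃ / Real.log 2) :=
      Real.exp_le_exp.mpr (div_le_div_of_nonneg_left hC₃0 hlog2 hlogw2)
    have hu0 : 0 ≤ C₃ / Real.log w := by positivity
    calc Real.exp (C₃ / Real.log w) ≤ 1 + C₃ / Real.log w * Real.exp (C₃ / Real.log w) := hu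
      _ ≤ 1 + C₃ / Real.log w * Real.exp (C₃ / Real.log 2) := by gcongr
      _ = 1 + C₃ * Real.exp (C₃ / Real.log 2) / Real.log w := by ring
  calc ∏ p ∈ S, (1 - (rho p : ℝ) / p)⁻¹
      ≤ Real.exp (∑ p ∈ S, ((rho p : ℝ) / p + 2 * ((rho p : ℝ) / p) ^ 2)) := h1
    _ ≤ Real.exp (Real.log (Real.log z / Real.log w) + C₃ / Real.log w) := Real.exp_le_exp.mpr h2
    _ = Real.log z / Real.log w * Real.exp (C₃ / Real.log w) := h3
    _ ≤ Real.log z / Real.log w * (1 + C₃ * Real.exp (C₃ / Real.log 2) / Real.log w) := by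
        gcongr


/-- **Condition (1) of Lemma 2 (`lemma2_bilinearSieve`) for `ω = ρ` — PROVED**: there is an
absolute `K ≥ 1` with `∏_{w ≤ p < z} (1 − ρ(p)/p)⁻¹ ≤ (log z/log w)(1 + K/log w)` for all
`2 ≤ w < z` (Iwaniec 1978, p. 185: "by our assumption on the sifting density of `ρ`"; Acta Arith.
37 (1980), condition (1) p. 308). [cite: IwaniecInventiones1978, §5 p. 185] -/
theorem rho_sieveConditionOne :
    ∃ K : ℝ, 1 ≤ K ∧ ∀ w z : ℝ, 2 ≤ w → w < z →
      ∏ p ∈ (Nat.primesBelow ⌈z⌉₊).filter (fun p : ℕ => w ≤ (p : ℝ)), (1 - (rho p : ℝ) / p)⁻¹ ≤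
        Real.log z / Real.log w * (1 + K / Real.log w) := by
  obtain ⟨C, hC⟩ := RhoMertensStrong_holds
  exact prod_inv_one_sub_rho_div_le hC

/-- The tail form of Mertens II for `ρ` with an absolute constant — PROVED:
`∑_{w ≤ p < z} ρ(p)/p ≤ log(log z / log w) + C₂ / log w` for `2 ≤ w < z`. [folklore] -/
theorem exists_sum_rho_div_filter_le :
    ∃ C₂ : ℝ, ∀ w z : ℝ, 2 ≤ w → w < z →
      ∑ p ∈ (Nat.primesBelow ⌈z⌉₊).filter (fun p : ℕ => w ≤ (p : ℝ)), (rho p : ℝ) / p ≤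
        Real.log (Real.log z / Real.log w) + C₂ / Real.log w := by
  obtain ⟨C, hC⟩ := RhoMertensStrong_holds
  exact ⟨5 + 12 * C, fun w z hw hwz => sum_rho_div_filter_le hC hw hwz⟩

end Literature.NumberTheory.Sieve.Iwaniec1978

end
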